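import Mathlib
import HarnessLib

/-!
# Triple integrals over regions of elementary type are iterated integrals with variable limits

Topic `Literature/MeasureTheory/Integral`; namespace `Literature.MeasureTheory.Integral`.  Sequel of
`RegionBetweenIntegral.lean` (the plane case: Hurley, *Intermediate Calculus* (1980), Sect. 5.3 formula (3)).

THE STATEMENT.  For an elementary region in space,
`D = {(x, y, z) | a ≤ x ≤ b, L₁(x) ≤ y ≤ U₁(x), L₂(x, y) ≤ z ≤ U₂(x, y)}`, and `f` integrable over `D`,
`∭_D f dV = ∫ₐᵇ dx ∫_{L₁(x)}^{U₁(x)} dy ∫_{L₂(x,y)}^{U₂(x,y)} f(x, y, z) dz`.  Hurley (1980), Sect. 5.6, Theorem 6.3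
with formula (3) states the reduction `∭_E f dV = ∬_{D'} dA ∫_{g₁(x,y)}^{g₂(x,y)} f dz` to a double integral over the
projection `D'` of `E`, "evaluated by the methods of Section 3" (the plane formula (3) of Sect. 5.3) — together the
displayed iterated integral; Davis–Rabinowitz, *Methods of Numerical Integration* (2nd ed., 1984), Sect. 5.6.1
(5.6.1.1) write it for general `d` (the starting point of the generalized product rules, whose kernel-checked
Gauss–Legendre certificates in `Literature/Analysis/ValidatedNumerics/GaussLegendreCert*` bound exactly the right-hand
side).  As in the plane case the proof is: extend `f` by zero, apply Fubini on a product set, and discard the zero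
part of each fibre integral.  We give BOTH groupings: Theorem 6.3 (3) literally (base a measurable plane set
`D' ⊆ ℝ × ℝ`, fibres `[g₁, g₂]`, ambient `(ℝ × ℝ) × ℝ`: `setIntegral_regionOverBase_eq_integral_integral`), and the
grouping natural for Lean's right-nested `ℝ × ℝ × ℝ` — outer `x`, then the plane fibre
`D(x) = {(y, z) | L₁ x ≤ y ≤ U₁ x, L₂ x y ≤ z ≤ U₂ x y}`, then `y` inside the fibre — which yields the iterated form.

WHAT IS PROVED (Lebesgue integrals, `volume` on `ℝ × ℝ × ℝ = ℝ × (ℝ × ℝ)`):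

* `setIntegral_fibredSet_eq_integral_integral` — Fubini for a FIBRED measurable set
  `{(x, y) | x ∈ s, y ∈ T x} ⊆ α × β` over two `MeasureSpace`s with s-finite volumes (the plane file's lemma is the case
  `α = β = ℝ`), and `ae_integrableOn_fibre` — a function integrable on the fibred set is integrable on almost every
  fibre.
* `regionOverBase g₁ g₂ D'` with `measurableSet_regionOverBase` and `setIntegral_regionOverBase_eq_integral_integral`
  — Theorem 6.3 (3) as stated (base any measurable plane set); `integrableOn_fibreIntegral_regionOverBase` (the inner
  integral is integrable on the base) and `setIntegral_regionOverBase_eq_iterated` — (3) followed by the plane formula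
  over a base of type I, i.e. the iterated integral `dz dy dx` in the book's grouping `((x, y), z)`;
  `regionOverBase_subset_box`, `Continuous.integrableOn_regionOverBase` and
  `setIntegral_regionOverBase_eq_iterated_of_continuous` — its hypothesis-light continuous case.
* `innerRegion₂ L₁ U₁ L₂ U₂ x` (the plane fibre `D(x)`), `closedRegionBetween₃ L₁ U₁ L₂ U₂ s` (the region `D`, base
  `x ∈ s`), their measurability, and the set-integral forms `setIntegral_innerRegion₂_eq_integral_integral`,
  `setIntegral_closedRegionBetween₃_eq_integral_setIntegral` (outer `x`, inner plane fibre) and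
  `setIntegral_closedRegionBetween₃_eq_integral_integral_integral` (fibres `Icc`, any measurable base `s`, for `f`
  integrable on `D` — the inner identity is used for almost every `x`, which is all Fubini gives and all that is needed).
* THE INTERVAL FORM: `setIntegral_closedRegionBetween₃_eq_iterated` — for `a ≤ b`, `L₁ ≤ U₁` on `[a, b]` and
  `L₂ x ≤ U₂ x` on `[L₁ x, U₁ x]`, `∫ p in D, f p = ∫ x in a..b, ∫ y in L₁ x..U₁ x, ∫ z in L₂ x y..U₂ x y, f (x, y, z)`.
* THE CONTINUOUS CASE, hypothesis-light for clients: `closedRegionBetween₃_subset_box` (`D` lies in a compact box when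
  the limit functions are continuous), `Continuous.integrableOn_closedRegionBetween₃`, and
  `setIntegral_closedRegionBetween₃_eq_iterated_of_continuous` — continuous limits with the two order hypotheses and a
  continuous `f` give the iterated form with no measurability or integrability side condition.

Mathlib anchors: `MeasureTheory.setIntegral_prod`, `MeasureTheory.Integrable.prod_right_ae`,
`MeasureTheory.setIntegral_indicator`, `MeasureTheory.integrable_indicator_iff`, `MeasureTheory.setIntegral_congr_ae`,
`intervalIntegral.integral_of_le`, `MeasureTheory.integral_Icc_eq_integral_Ioc`, `ContinuousOn.integrableOn_compact`.
Mathlib has `regionBetween` (plane, open fibres) with its MEASURE only; the in-tree "`…_eq_iterated`" helpers are for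
constant limits (boxes, slabs, cylinders).  HONEST FRAMING: a textbook identity, formalised as glue between region
integrals and the iterated integrals that the shared numerical engines certify; every published number belongs to a
client cell's ledger, and its rigour lives in the kernel-checked verifier it cites, not here.  Deliberately NOT here:
other orders of integration / regions of types II–VI (permute coordinates with a measure-preserving equivalence first),
`d ≥ 4` (iterate `setIntegral_fibredSet_eq_integral_integral`), change of variables.  Everything is proved; no named
fact, no axiom, no `sorry`.

References: [cite: Hurley1980, Sect. 5.6 Thm. 6.3 (3)]; [cite: Hurley1980, Sect. 5.3 (3)];
[cite: DavisRabinowitz1984, Sect. 5.6.1 (5.6.1.1)].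

AI-produced formalisation (H21 engines group, seat eng-quad-3 gen 65, 2026-08-24).
-/

open _root_.MeasureTheory Set intervalIntegral Function
open scoped Interval

namespace Literature.MeasureTheory.Integral

/-! ### Fubini for a fibred measurable set in a product of measure spaces -/

/-- **Fubini for a fibred set** `S = {(x, y) | x ∈ s, y ∈ T x} ⊆ α × β` with measurable fibres: extend `f` by zero to
the cylinder `s × β`, integrate iteratedly there (`MeasureTheory.setIntegral_prod`), and drop the zero part of each
fibre integral. [cite: Hurley1980, Sect. 5.6 Thm. 6.3 (3)] -/
theorem setIntegral_fibredSet_eq_integral_integral {α β : Type*} [MeasureSpace α] [MeasureSpace β]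
    [SFinite (volume : Measure α)] [SFinite (volume : Measure β)] {s : Set α} (hs : MeasurableSet s)
    (T : α → Set β) (hT : ∀ x, MeasurableSet (T x)) (hS : MeasurableSet {p : α × β | p.1 ∈ s ∧ p.2 ∈ T p.1})
    {f : α × β → ℝ} (hf : IntegrableOn f {p : α × β | p.1 ∈ s ∧ p.2 ∈ T p.1}) :
    ∫ p in {p : α × β | p.1 ∈ s ∧ p.2 ∈ T p.1}, f p = ∫ x in s, ∫ y in T x, f (x, y) := by
  set S : Set (α × β) := {p : α × β | p.1 ∈ s ∧ p.2 ∈ T p.1} with hSdef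
  have hsub : S ⊆ s ×ˢ (univ : Set β) := fun p hp => ⟨hp.1, trivial⟩
  have h1 : ∫ p in S, f p = ∫ p in s ×ˢ (univ : Set β), S.indicator f p := by
    rw [setIntegral_indicator hS, inter_eq_self_of_subset_right hsub]
  have hint : IntegrableOn (S.indicator f) (s ×ˢ (univ : Set β)) ((volume : Measure α).prod volume) := by
    have h2 : Integrable (S.indicator f) (volume : Measure (α × β)) := (integrable_indicator_iff hS).2 hf
    exact h2.integrableOn
  rw [h1, Measure.volume_eq_prod, setIntegral_prod _ hint]
  refine setIntegral_congr_fun hs fun x hx => ?_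
  have h3 : (fun y => S.indicator f (x, y)) = (T x).indicator fun y => f (x, y) := by
    funext y
    by_cases hy : y ∈ T x
    · rw [indicator_of_mem (show (x, y) ∈ S from ⟨hx, hy⟩), indicator_of_mem hy]
    · rw [indicator_of_notMem (show (x, y) ∉ S from fun h => hy h.2), indicator_of_notMem hy]
  simp only [Measure.restrict_univ, h3]
  exact MeasureTheory.integral_indicator (hT x)

/-- A function integrable on a fibred measurable set is integrable on ALMOST EVERY fibre (Fubini; "every" is false in
general). [cite: Hurley1980, Sect. 5.6 Thm. 6.3 (3)] -/
theorem ae_integrableOn_fibre {α β : Type*} [MeasureSpace α] [MeasureSpace β]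
    [SFinite (volume : Measure α)] [SFinite (volume : Measure β)] {s : Set α}
    (T : α → Set β) (hT : ∀ x, MeasurableSet (T x)) (hS : MeasurableSet {p : α × β | p.1 ∈ s ∧ p.2 ∈ T p.1})
    {f : α × β → ℝ} (hf : IntegrableOn f {p : α × β | p.1 ∈ s ∧ p.2 ∈ T p.1}) :
    ∀ᵐ x : α, x ∈ s → IntegrableOn (fun y => f (x, y)) (T x) := by
  set S : Set (α × β) := {p : α × β | p.1 ∈ s ∧ p.2 ∈ T p.1} with hSdef
  have h2 : Integrable (S.indicator f) ((volume : Measure α).prod volume) := by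
    rw [← Measure.volume_eq_prod]; exact (integrable_indicator_iff hS).2 hf
  filter_upwards [h2.prod_right_ae] with x hx hxs
  have h3 : (fun y => S.indicator f (x, y)) = (T x).indicator fun y => f (x, y) := by
    funext y
    by_cases hy : y ∈ T x
    · rw [indicator_of_mem (show (x, y) ∈ S from ⟨hxs, hy⟩), indicator_of_mem hy]
    · rw [indicator_of_notMem (show (x, y) ∉ S from fun h => hy h.2), indicator_of_notMem hy]
  rw [h3] at hx
  exact (integrable_indicator_iff (hT x)).1 hx

/-! ### Theorem 6.3 (3) literally: a measurable plane base and fibres between two graphs over it -/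

/-- The region `E = {(q, z) | q ∈ D', g₁ q ≤ z ≤ g₂ q} ⊆ (ℝ × ℝ) × ℝ` over a plane base `D'`.
[cite: Hurley1980, Sect. 5.6 Thm. 6.3 (3)] -/
def regionOverBase (g₁ g₂ : ℝ × ℝ → ℝ) (D : Set (ℝ × ℝ)) : Set ((ℝ × ℝ) × ℝ) :=
  {p : (ℝ × ℝ) × ℝ | p.1 ∈ D ∧ p.2 ∈ Icc (g₁ p.1) (g₂ p.1)}

/-- `E` is measurable for measurable data. [cite: Hurley1980, Sect. 5.6 Thm. 6.3 (3)] -/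
theorem measurableSet_regionOverBase {g₁ g₂ : ℝ × ℝ → ℝ} (hg₁ : Measurable g₁) (hg₂ : Measurable g₂)
    {D : Set (ℝ × ℝ)} (hD : MeasurableSet D) : MeasurableSet (regionOverBase g₁ g₂ D) := by
  have e : regionOverBase g₁ g₂ D = (Prod.fst ⁻¹' D) ∩
      ({p : (ℝ × ℝ) × ℝ | g₁ p.1 ≤ p.2} ∩ {p : (ℝ × ℝ) × ℝ | p.2 ≤ g₂ p.1}) := by
    ext p; simp [regionOverBase]
  rw [e]
  exact (measurable_fst hD).inter
    ((measurableSet_le (hg₁.comp measurable_fst) measurable_snd).inter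
      (measurableSet_le measurable_snd (hg₂.comp measurable_fst)))

/-- **Hurley's Theorem 5.6.3, formula (3)**: `∭_E f dV = ∬_{D'} (∫_{g₁(q)}^{g₂(q)} f(q, z) dz) dA` for a measurable
plane base `D'`, measurable `g₁, g₂` and `f` integrable on `E` (the fibre integral as a set integral over
`Icc (g₁ q) (g₂ q)`; for `g₁ q ≤ g₂ q` it is the interval integral `∫ z in g₁ q..g₂ q`, by
`intervalIntegral.integral_of_le` and `MeasureTheory.integral_Icc_eq_integral_Ioc`). The double integral over `D'` is
then evaluated by the plane file's formula (3) of Sect. 5.3. [cite: Hurley1980, Sect. 5.6 Thm. 6.3 (3)] -/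
theorem setIntegral_regionOverBase_eq_integral_integral {g₁ g₂ : ℝ × ℝ → ℝ} (hg₁ : Measurable g₁)
    (hg₂ : Measurable g₂) {D : Set (ℝ × ℝ)} (hD : MeasurableSet D) {f : (ℝ × ℝ) × ℝ → ℝ}
    (hf : IntegrableOn f (regionOverBase g₁ g₂ D)) :
    ∫ p in regionOverBase g₁ g₂ D, f p = ∫ q in D, ∫ z in Icc (g₁ q) (g₂ q), f (q, z) :=
  setIntegral_fibredSet_eq_integral_integral hD (fun q => Icc (g₁ q) (g₂ q)) (fun _ => measurableSet_Icc)
    (measurableSet_regionOverBase hg₁ hg₂ hD) hf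

/-! ### Theorem 6.3 (3) "evaluated by the methods of Section 3": the iterated integral in the book's grouping -/

/-- The fibre integral `q ↦ ∫ z in Icc (g₁ q) (g₂ q), f (q, z)` is integrable on the base `D'` when `f` is integrable
on `E` (Fubini: `MeasureTheory.Integrable.integral_prod_left` for the zero extension). [cite: Hurley1980, Sect. 5.6 Thm. 6.3 (3)] -/
theorem integrableOn_fibreIntegral_regionOverBase {g₁ g₂ : ℝ × ℝ → ℝ} (hg₁ : Measurable g₁) (hg₂ : Measurable g₂)
    {D : Set (ℝ × ℝ)} (hD : MeasurableSet D) {f : (ℝ × ℝ) × ℝ → ℝ} (hf : IntegrableOn f (regionOverBase g₁ g₂ D)) :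
    IntegrableOn (fun q => ∫ z in Icc (g₁ q) (g₂ q), f (q, z)) D := by
  set E : Set ((ℝ × ℝ) × ℝ) := regionOverBase g₁ g₂ D with hEdef
  have hE : MeasurableSet E := measurableSet_regionOverBase hg₁ hg₂ hD
  have h2 : Integrable (E.indicator f) ((volume : Measure (ℝ × ℝ)).prod volume) := by
    rw [← Measure.volume_eq_prod]; exact (integrable_indicator_iff hE).2 hf
  have h3 : Integrable (fun q => ∫ z, E.indicator f (q, z)) (volume : Measure (ℝ × ℝ)) := h2.integral_prod_left
  refine h3.integrableOn.congr_fun (fun q hq => ?_) hD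
  have h4 : (fun z => E.indicator f (q, z)) = (Icc (g₁ q) (g₂ q)).indicator fun z => f (q, z) := by
    funext z
    by_cases hz : z ∈ Icc (g₁ q) (g₂ q)
    · rw [indicator_of_mem (show (q, z) ∈ E from ⟨hq, hz⟩), indicator_of_mem hz]
    · rw [indicator_of_notMem (show (q, z) ∉ E from fun h => hz h.2), indicator_of_notMem hz]
  show ∫ z, E.indicator f (q, z) = ∫ z in Icc (g₁ q) (g₂ q), f (q, z)
  rw [h4]
  exact MeasureTheory.integral_indicator measurableSet_Icc

/-- **Theorem 6.3 (3) with the plane formula 5.3 (3)**, in the book's grouping `((x, y), z)`: for the base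
`D' = {(x, y) | a ≤ x ≤ b, L₁ x ≤ y ≤ U₁ x}` (the plane file's `closedRegionBetween L₁ U₁ (Icc a b)`), `a ≤ b`,
`L₁ ≤ U₁` on `[a, b]`, `g₁ ≤ g₂` on `D'`, measurable data and `f` integrable on `E`,
`∭_E f dV = ∫ x in a..b, ∫ y in L₁ x..U₁ x, ∫ z in g₁ (x, y)..g₂ (x, y), f ((x, y), z)`.
[cite: Hurley1980, Sect. 5.6 Thm. 6.3 (3)] [cite: DavisRabinowitz1984, Sect. 5.6.1 (5.6.1.1)] -/
theorem setIntegral_regionOverBase_eq_iterated {g₁ g₂ : ℝ × ℝ → ℝ} {L₁ U₁ : ℝ → ℝ} {a b : ℝ} (hab : a ≤ b)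
    (hL₁ : Measurable L₁) (hU₁ : Measurable U₁) (hg₁ : Measurable g₁) (hg₂ : Measurable g₂)
    (h₁ : ∀ x ∈ Icc a b, L₁ x ≤ U₁ x) (h₂ : ∀ x ∈ Icc a b, ∀ y ∈ Icc (L₁ x) (U₁ x), g₁ (x, y) ≤ g₂ (x, y))
    {f : (ℝ × ℝ) × ℝ → ℝ}
    (hf : IntegrableOn f (regionOverBase g₁ g₂ {q : ℝ × ℝ | q.1 ∈ Icc a b ∧ q.2 ∈ Icc (L₁ q.1) (U₁ q.1)})) :
    ∫ p in regionOverBase g₁ g₂ {q : ℝ × ℝ | q.1 ∈ Icc a b ∧ q.2 ∈ Icc (L₁ q.1) (U₁ q.1)}, f p =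
      ∫ x in a..b, ∫ y in L₁ x..U₁ x, ∫ z in g₁ (x, y)..g₂ (x, y), f ((x, y), z) := by
  have hD : MeasurableSet {q : ℝ × ℝ | q.1 ∈ Icc a b ∧ q.2 ∈ Icc (L₁ q.1) (U₁ q.1)} := by
    have e : {q : ℝ × ℝ | q.1 ∈ Icc a b ∧ q.2 ∈ Icc (L₁ q.1) (U₁ q.1)} =
        (Prod.fst ⁻¹' Icc a b) ∩ ({q : ℝ × ℝ | L₁ q.1 ≤ q.2} ∩ {q : ℝ × ℝ | q.2 ≤ U₁ q.1}) := by
      ext q; simp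
    rw [e]
    exact (measurable_fst measurableSet_Icc).inter
      ((measurableSet_le (hL₁.comp measurable_fst) measurable_snd).inter
        (measurableSet_le measurable_snd (hU₁.comp measurable_fst)))
  have key : ∫ q in {q : ℝ × ℝ | q.1 ∈ Icc a b ∧ q.2 ∈ Icc (L₁ q.1) (U₁ q.1)}, ∫ z in Icc (g₁ q) (g₂ q), f (q, z) =
      ∫ x in Icc a b, ∫ y in Icc (L₁ x) (U₁ x), ∫ z in Icc (g₁ (x, y)) (g₂ (x, y)), f ((x, y), z) :=
    setIntegral_fibredSet_eq_integral_integral measurableSet_Icc (fun x => Icc (L₁ x) (U₁ x))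
      (fun _ => measurableSet_Icc) hD (integrableOn_fibreIntegral_regionOverBase hg₁ hg₂ hD hf)
  rw [setIntegral_regionOverBase_eq_integral_integral hg₁ hg₂ hD hf, key, intervalIntegral.integral_of_le hab,
    integral_Icc_eq_integral_Ioc]
  refine setIntegral_congr_fun measurableSet_Ioc fun x hx => ?_
  have hx' : x ∈ Icc a b := Ioc_subset_Icc_self hx
  rw [intervalIntegral.integral_of_le (h₁ x hx'), integral_Icc_eq_integral_Ioc]
  refine setIntegral_congr_fun measurableSet_Ioc fun y hy => ?_
  have hy' : y ∈ Icc (L₁ x) (U₁ x) := Ioc_subset_Icc_self hy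
  simp only [intervalIntegral.integral_of_le (h₂ x hx' y hy'), integral_Icc_eq_integral_Ioc]

/-- With continuous data over a base of type I, the solid `E` lies in a compact box `([a, b] × [m₁, M₁]) × [m₂, M₂]`.
[cite: Hurley1980, Sect. 5.6 Thm. 6.3 (3)] -/
theorem regionOverBase_subset_box {g₁ g₂ : ℝ × ℝ → ℝ} {L₁ U₁ : ℝ → ℝ} {a b : ℝ} (hL₁ : Continuous L₁)
    (hU₁ : Continuous U₁) (hg₁ : Continuous g₁) (hg₂ : Continuous g₂) :
    ∃ m₁ M₁ m₂ M₂ : ℝ, regionOverBase g₁ g₂ {q : ℝ × ℝ | q.1 ∈ Icc a b ∧ q.2 ∈ Icc (L₁ q.1) (U₁ q.1)} ⊆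
      (Icc a b ×ˢ Icc m₁ M₁) ×ˢ Icc m₂ M₂ := by
  obtain ⟨m₁, hm₁⟩ := isCompact_Icc.bddBelow_image (f := L₁) (K := Icc a b) hL₁.continuousOn
  obtain ⟨M₁, hM₁⟩ := isCompact_Icc.bddAbove_image (f := U₁) (K := Icc a b) hU₁.continuousOn
  have hK : IsCompact (Icc a b ×ˢ Icc m₁ M₁) := isCompact_Icc.prod isCompact_Icc
  obtain ⟨m₂, hm₂⟩ := hK.bddBelow_image hg₁.continuousOn
  obtain ⟨M₂, hM₂⟩ := hK.bddAbove_image hg₂.continuousOn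
  refine ⟨m₁, M₁, m₂, M₂, fun p hp => ?_⟩
  obtain ⟨⟨hx, hy1, hy2⟩, hz1, hz2⟩ := hp
  have hy : p.1.2 ∈ Icc m₁ M₁ :=
    ⟨(hm₁ (mem_image_of_mem L₁ hx)).trans hy1, hy2.trans (hM₁ (mem_image_of_mem U₁ hx))⟩
  have hq : p.1 ∈ Icc a b ×ˢ Icc m₁ M₁ := ⟨hx, hy⟩
  exact ⟨hq, (hm₂ (mem_image_of_mem g₁ hq)).trans hz1, hz2.trans (hM₂ (mem_image_of_mem g₂ hq))⟩

/-- A continuous function is integrable on the solid `E` over a base of type I with continuous limit functions.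
[cite: Hurley1980, Sect. 5.6 Thm. 6.3 (3)] -/
theorem _root_.Continuous.integrableOn_regionOverBase {g₁ g₂ : ℝ × ℝ → ℝ} {L₁ U₁ : ℝ → ℝ} {a b : ℝ}
    {f : (ℝ × ℝ) × ℝ → ℝ} (hf : Continuous f) (hL₁ : Continuous L₁) (hU₁ : Continuous U₁) (hg₁ : Continuous g₁)
    (hg₂ : Continuous g₂) :
    IntegrableOn f (regionOverBase g₁ g₂ {q : ℝ × ℝ | q.1 ∈ Icc a b ∧ q.2 ∈ Icc (L₁ q.1) (U₁ q.1)}) := by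
  obtain ⟨m₁, M₁, m₂, M₂, hsub⟩ := regionOverBase_subset_box (a := a) (b := b) hL₁ hU₁ hg₁ hg₂
  exact (hf.continuousOn.integrableOn_compact
    ((isCompact_Icc.prod isCompact_Icc).prod isCompact_Icc)).mono_set hsub

/-- **Theorem 6.3 (3) with 5.3 (3), continuous case** (the book's standing hypotheses): continuous `L₁ ≤ U₁` on
`[a, b]`, continuous `g₁ ≤ g₂` on the base, `a ≤ b`, `f` continuous:
`∭_E f dV = ∫ x in a..b, ∫ y in L₁ x..U₁ x, ∫ z in g₁ (x, y)..g₂ (x, y), f ((x, y), z)`, no side conditions.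
[cite: Hurley1980, Sect. 5.6 Thm. 6.3 (3)] [cite: DavisRabinowitz1984, Sect. 5.6.1 (5.6.1.1)] -/
theorem setIntegral_regionOverBase_eq_iterated_of_continuous {g₁ g₂ : ℝ × ℝ → ℝ} {L₁ U₁ : ℝ → ℝ} {a b : ℝ}
    (hab : a ≤ b) (hL₁ : Continuous L₁) (hU₁ : Continuous U₁) (hg₁ : Continuous g₁) (hg₂ : Continuous g₂)
    (h₁ : ∀ x ∈ Icc a b, L₁ x ≤ U₁ x) (h₂ : ∀ x ∈ Icc a b, ∀ y ∈ Icc (L₁ x) (U₁ x), g₁ (x, y) ≤ g₂ (x, y))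
    {f : (ℝ × ℝ) × ℝ → ℝ} (hf : Continuous f) :
    ∫ p in regionOverBase g₁ g₂ {q : ℝ × ℝ | q.1 ∈ Icc a b ∧ q.2 ∈ Icc (L₁ q.1) (U₁ q.1)}, f p =
      ∫ x in a..b, ∫ y in L₁ x..U₁ x, ∫ z in g₁ (x, y)..g₂ (x, y), f ((x, y), z) :=
  setIntegral_regionOverBase_eq_iterated hab hL₁.measurable hU₁.measurable hg₁.measurable hg₂.measurable h₁ h₂
    (hf.integrableOn_regionOverBase hL₁ hU₁ hg₁ hg₂)

/-! ### The region of elementary type in space and its plane fibres -/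

/-- The plane fibre `D(x) = {(y, z) | L₁ x ≤ y ≤ U₁ x, L₂ x y ≤ z ≤ U₂ x y}` of the region (a closed region between two
graphs over `[L₁ x, U₁ x]`). [cite: Hurley1980, Sect. 5.6 Thm. 6.3 (3)] -/
def innerRegion₂ (L₁ U₁ : ℝ → ℝ) (L₂ U₂ : ℝ → ℝ → ℝ) (x : ℝ) : Set (ℝ × ℝ) :=
  {q : ℝ × ℝ | q.1 ∈ Icc (L₁ x) (U₁ x) ∧ q.2 ∈ Icc (L₂ x q.1) (U₂ x q.1)}

/-- The region of elementary type `D = {(x, y, z) | x ∈ s, L₁ x ≤ y ≤ U₁ x, L₂ x y ≤ z ≤ U₂ x y}` (base `s`, usually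
`Icc a b`). [cite: Hurley1980, Sect. 5.6 Thm. 6.3 (3)] -/
def closedRegionBetween₃ (L₁ U₁ : ℝ → ℝ) (L₂ U₂ : ℝ → ℝ → ℝ) (s : Set ℝ) : Set (ℝ × ℝ × ℝ) :=
  {p : ℝ × ℝ × ℝ | p.1 ∈ s ∧ p.2 ∈ innerRegion₂ L₁ U₁ L₂ U₂ p.1}

/-- Membership in the region, spelled out. [cite: Hurley1980, Sect. 5.6 Thm. 6.3 (3)] -/
theorem mem_closedRegionBetween₃ {L₁ U₁ : ℝ → ℝ} {L₂ U₂ : ℝ → ℝ → ℝ} {s : Set ℝ} {p : ℝ × ℝ × ℝ} :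
    p ∈ closedRegionBetween₃ L₁ U₁ L₂ U₂ s ↔
      p.1 ∈ s ∧ (L₁ p.1 ≤ p.2.1 ∧ p.2.1 ≤ U₁ p.1) ∧ (L₂ p.1 p.2.1 ≤ p.2.2 ∧ p.2.2 ≤ U₂ p.1 p.2.1) := by
  simp [closedRegionBetween₃, innerRegion₂]

/-- The plane fibre is measurable for measurable limit functions. [cite: Hurley1980, Sect. 5.6 Thm. 6.3 (3)] -/
theorem measurableSet_innerRegion₂ {L₁ U₁ : ℝ → ℝ} {L₂ U₂ : ℝ → ℝ → ℝ} (hL₂ : Measurable (uncurry L₂))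
    (hU₂ : Measurable (uncurry U₂)) (x : ℝ) : MeasurableSet (innerRegion₂ L₁ U₁ L₂ U₂ x) := by
  have hl : Measurable fun y : ℝ => L₂ x y := hL₂.comp measurable_prodMk_left
  have hu : Measurable fun y : ℝ => U₂ x y := hU₂.comp measurable_prodMk_left
  have e : innerRegion₂ L₁ U₁ L₂ U₂ x = (Prod.fst ⁻¹' Icc (L₁ x) (U₁ x)) ∩
      ({q : ℝ × ℝ | L₂ x q.1 ≤ q.2} ∩ {q : ℝ × ℝ | q.2 ≤ U₂ x q.1}) := by
    ext q; simp [innerRegion₂]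
  rw [e]
  exact (measurable_fst measurableSet_Icc).inter
    ((measurableSet_le (hl.comp measurable_fst) measurable_snd).inter
      (measurableSet_le measurable_snd (hu.comp measurable_fst)))

/-- The region is measurable for measurable data. [cite: Hurley1980, Sect. 5.6 Thm. 6.3 (3)] -/
theorem measurableSet_closedRegionBetween₃ {L₁ U₁ : ℝ → ℝ} {L₂ U₂ : ℝ → ℝ → ℝ} (hL₁ : Measurable L₁)
    (hU₁ : Measurable U₁) (hL₂ : Measurable (uncurry L₂)) (hU₂ : Measurable (uncurry U₂)) {s : Set ℝ}
    (hs : MeasurableSet s) : MeasurableSet (closedRegionBetween₃ L₁ U₁ L₂ U₂ s) := by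
  have hxy : Measurable fun p : ℝ × ℝ × ℝ => (p.1, p.2.1) := measurable_fst.prodMk measurable_snd.fst
  have e : closedRegionBetween₃ L₁ U₁ L₂ U₂ s = (Prod.fst ⁻¹' s) ∩
      (({p : ℝ × ℝ × ℝ | L₁ p.1 ≤ p.2.1} ∩ {p : ℝ × ℝ × ℝ | p.2.1 ≤ U₁ p.1}) ∩
        ({p : ℝ × ℝ × ℝ | uncurry L₂ (p.1, p.2.1) ≤ p.2.2} ∩ {p : ℝ × ℝ × ℝ | p.2.2 ≤ uncurry U₂ (p.1, p.2.1)})) := by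
    ext p; simp [closedRegionBetween₃, innerRegion₂]
  rw [e]
  refine (measurable_fst hs).inter (MeasurableSet.inter ?_ ?_)
  · exact (measurableSet_le (hL₁.comp measurable_fst) measurable_snd.fst).inter
      (measurableSet_le measurable_snd.fst (hU₁.comp measurable_fst))
  · exact (measurableSet_le (hL₂.comp hxy) measurable_snd.snd).inter
      (measurableSet_le measurable_snd.snd (hU₂.comp hxy))

/-! ### The set-integral forms -/

/-- Fubini on the plane fibre: `∫ q in D(x), g q = ∫ y in Icc (L₁ x) (U₁ x), ∫ z in Icc (L₂ x y) (U₂ x y), g (y, z)` for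
`g` integrable on `D(x)`. [cite: Hurley1980, Sect. 5.3 (3)] -/
theorem setIntegral_innerRegion₂_eq_integral_integral {L₁ U₁ : ℝ → ℝ} {L₂ U₂ : ℝ → ℝ → ℝ}
    (hL₂ : Measurable (uncurry L₂)) (hU₂ : Measurable (uncurry U₂)) (x : ℝ) {g : ℝ × ℝ → ℝ}
    (hg : IntegrableOn g (innerRegion₂ L₁ U₁ L₂ U₂ x)) :
    ∫ q in innerRegion₂ L₁ U₁ L₂ U₂ x, g q = ∫ y in Icc (L₁ x) (U₁ x), ∫ z in Icc (L₂ x y) (U₂ x y), g (y, z) :=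
  setIntegral_fibredSet_eq_integral_integral measurableSet_Icc (fun y => Icc (L₂ x y) (U₂ x y))
    (fun _ => measurableSet_Icc) (measurableSet_innerRegion₂ hL₂ hU₂ x) hg

/-- Fubini, outer variable against the plane fibre: `∫ p in D, f p = ∫ x in s, ∫ q in D(x), f (x, q)` for `f`
integrable on `D`. [cite: Hurley1980, Sect. 5.6 Thm. 6.3 (3)] -/
theorem setIntegral_closedRegionBetween₃_eq_integral_setIntegral {L₁ U₁ : ℝ → ℝ} {L₂ U₂ : ℝ → ℝ → ℝ}
    (hL₁ : Measurable L₁) (hU₁ : Measurable U₁) (hL₂ : Measurable (uncurry L₂)) (hU₂ : Measurable (uncurry U₂))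
    {s : Set ℝ} (hs : MeasurableSet s) {f : ℝ × ℝ × ℝ → ℝ} (hf : IntegrableOn f (closedRegionBetween₃ L₁ U₁ L₂ U₂ s)) :
    ∫ p in closedRegionBetween₃ L₁ U₁ L₂ U₂ s, f p = ∫ x in s, ∫ q in innerRegion₂ L₁ U₁ L₂ U₂ x, f (x, q) :=
  setIntegral_fibredSet_eq_integral_integral hs (innerRegion₂ L₁ U₁ L₂ U₂) (measurableSet_innerRegion₂ hL₂ hU₂)
    (measurableSet_closedRegionBetween₃ hL₁ hU₁ hL₂ hU₂ hs) hf

/-- **Fubini over a region of elementary type in space (set-integral form)**: for measurable data and `f` integrable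
on `D`, `∫ p in D, f p = ∫ x in s, ∫ y in Icc (L₁ x) (U₁ x), ∫ z in Icc (L₂ x y) (U₂ x y), f (x, y, z)` (the inner
identity holds for almost every `x`, by `ae_integrableOn_fibre`). [cite: Hurley1980, Sect. 5.6 Thm. 6.3 (3)] -/
theorem setIntegral_closedRegionBetween₃_eq_integral_integral_integral {L₁ U₁ : ℝ → ℝ} {L₂ U₂ : ℝ → ℝ → ℝ}
    (hL₁ : Measurable L₁) (hU₁ : Measurable U₁) (hL₂ : Measurable (uncurry L₂)) (hU₂ : Measurable (uncurry U₂))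
    {s : Set ℝ} (hs : MeasurableSet s) {f : ℝ × ℝ × ℝ → ℝ} (hf : IntegrableOn f (closedRegionBetween₃ L₁ U₁ L₂ U₂ s)) :
    ∫ p in closedRegionBetween₃ L₁ U₁ L₂ U₂ s, f p =
      ∫ x in s, ∫ y in Icc (L₁ x) (U₁ x), ∫ z in Icc (L₂ x y) (U₂ x y), f (x, y, z) := by
  rw [setIntegral_closedRegionBetween₃_eq_integral_setIntegral hL₁ hU₁ hL₂ hU₂ hs hf]
  refine setIntegral_congr_ae hs ?_
  filter_upwards [ae_integrableOn_fibre (innerRegion₂ L₁ U₁ L₂ U₂) (measurableSet_innerRegion₂ hL₂ hU₂)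
    (measurableSet_closedRegionBetween₃ hL₁ hU₁ hL₂ hU₂ hs) hf] with x hx hxs
  exact setIntegral_innerRegion₂_eq_integral_integral hL₂ hU₂ x (hx hxs)

/-! ### The interval-integral form -/

/-- **The iterated form (op. cit. Thm. 5.6.3 (3) with Sect. 5.3 (3))**: for `a ≤ b`, `L₁ ≤ U₁` on `[a, b]`, `L₂ x ≤ U₂ x` on `[L₁ x, U₁ x]`
(`x ∈ [a, b]`), measurable limit functions and `f` integrable on `D`,
`∫ p in D, f p = ∫ x in a..b, ∫ y in L₁ x..U₁ x, ∫ z in L₂ x y..U₂ x y, f (x, y, z)` — the triple integral over a region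
of elementary type as the iterated integral with variable limits (Davis–Rabinowitz (5.6.1.1), `d = 3`).
[cite: Hurley1980, Sect. 5.6 Thm. 6.3 (3)] [cite: DavisRabinowitz1984, Sect. 5.6.1 (5.6.1.1)] -/
theorem setIntegral_closedRegionBetween₃_eq_iterated {L₁ U₁ : ℝ → ℝ} {L₂ U₂ : ℝ → ℝ → ℝ} {a b : ℝ} (hab : a ≤ b)
    (hL₁ : Measurable L₁) (hU₁ : Measurable U₁) (hL₂ : Measurable (uncurry L₂)) (hU₂ : Measurable (uncurry U₂))
    (h₁ : ∀ x ∈ Icc a b, L₁ x ≤ U₁ x) (h₂ : ∀ x ∈ Icc a b, ∀ y ∈ Icc (L₁ x) (U₁ x), L₂ x y ≤ U₂ x y)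
    {f : ℝ × ℝ × ℝ → ℝ} (hf : IntegrableOn f (closedRegionBetween₃ L₁ U₁ L₂ U₂ (Icc a b))) :
    ∫ p in closedRegionBetween₃ L₁ U₁ L₂ U₂ (Icc a b), f p =
      ∫ x in a..b, ∫ y in L₁ x..U₁ x, ∫ z in L₂ x y..U₂ x y, f (x, y, z) := by
  rw [setIntegral_closedRegionBetween₃_eq_integral_integral_integral hL₁ hU₁ hL₂ hU₂ measurableSet_Icc hf,
    intervalIntegral.integral_of_le hab, integral_Icc_eq_integral_Ioc]
  refine setIntegral_congr_fun measurableSet_Ioc fun x hx => ?_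
  have hx' : x ∈ Icc a b := Ioc_subset_Icc_self hx
  rw [intervalIntegral.integral_of_le (h₁ x hx'), integral_Icc_eq_integral_Ioc]
  refine setIntegral_congr_fun measurableSet_Ioc fun y hy => ?_
  have hy' : y ∈ Icc (L₁ x) (U₁ x) := Ioc_subset_Icc_self hy
  simp only [intervalIntegral.integral_of_le (h₂ x hx' y hy'), integral_Icc_eq_integral_Ioc]

/-! ### The continuous case -/

/-- With continuous limit functions the region over `[a, b]` lies in a compact box
`[a, b] × [m₁, M₁] × [m₂, M₂]`. [cite: Hurley1980, Sect. 5.6 Thm. 6.3 (3)] -/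
theorem closedRegionBetween₃_subset_box {L₁ U₁ : ℝ → ℝ} {L₂ U₂ : ℝ → ℝ → ℝ} {a b : ℝ} (hL₁ : Continuous L₁)
    (hU₁ : Continuous U₁) (hL₂ : Continuous (uncurry L₂)) (hU₂ : Continuous (uncurry U₂)) :
    ∃ m₁ M₁ m₂ M₂ : ℝ, closedRegionBetween₃ L₁ U₁ L₂ U₂ (Icc a b) ⊆ Icc a b ×ˢ (Icc m₁ M₁ ×ˢ Icc m₂ M₂) := by
  obtain ⟨m₁, hm₁⟩ := isCompact_Icc.bddBelow_image (f := L₁) (K := Icc a b) hL₁.continuousOn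
  obtain ⟨M₁, hM₁⟩ := isCompact_Icc.bddAbove_image (f := U₁) (K := Icc a b) hU₁.continuousOn
  have hK : IsCompact (Icc a b ×ˢ Icc m₁ M₁) := isCompact_Icc.prod isCompact_Icc
  obtain ⟨m₂, hm₂⟩ := hK.bddBelow_image hL₂.continuousOn
  obtain ⟨M₂, hM₂⟩ := hK.bddAbove_image hU₂.continuousOn
  refine ⟨m₁, M₁, m₂, M₂, fun p hp => ?_⟩
  rw [mem_closedRegionBetween₃] at hp
  obtain ⟨hx, ⟨hy1, hy2⟩, hz1, hz2⟩ := hp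
  have hy : p.2.1 ∈ Icc m₁ M₁ :=
    ⟨(hm₁ (mem_image_of_mem L₁ hx)).trans hy1, hy2.trans (hM₁ (mem_image_of_mem U₁ hx))⟩
  have hxy : (p.1, p.2.1) ∈ Icc a b ×ˢ Icc m₁ M₁ := ⟨hx, hy⟩
  refine ⟨hx, hy, ?_, ?_⟩
  · exact (hm₂ (mem_image_of_mem (uncurry L₂) hxy)).trans hz1
  · exact hz2.trans (hM₂ (mem_image_of_mem (uncurry U₂) hxy))

/-- A continuous function is integrable on a region of elementary type with continuous limit functions over `[a, b]`
(the region is measurable and lies in a compact box). [cite: Hurley1980, Sect. 5.6 Thm. 6.3 (3)] -/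
theorem _root_.Continuous.integrableOn_closedRegionBetween₃ {L₁ U₁ : ℝ → ℝ} {L₂ U₂ : ℝ → ℝ → ℝ} {a b : ℝ}
    {f : ℝ × ℝ × ℝ → ℝ} (hf : Continuous f) (hL₁ : Continuous L₁) (hU₁ : Continuous U₁)
    (hL₂ : Continuous (uncurry L₂)) (hU₂ : Continuous (uncurry U₂)) :
    IntegrableOn f (closedRegionBetween₃ L₁ U₁ L₂ U₂ (Icc a b)) := by
  obtain ⟨m₁, M₁, m₂, M₂, hsub⟩ := closedRegionBetween₃_subset_box (a := a) (b := b) hL₁ hU₁ hL₂ hU₂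
  exact (hf.continuousOn.integrableOn_compact
    (isCompact_Icc.prod (isCompact_Icc.prod isCompact_Icc))).mono_set hsub

/-- **The iterated form, continuous case**: continuous limit functions with `L₁ ≤ U₁` on `[a, b]` and `L₂ x ≤ U₂ x` on
`[L₁ x, U₁ x]`, `a ≤ b`, and a continuous `f` give
`∫ p in D, f p = ∫ x in a..b, ∫ y in L₁ x..U₁ x, ∫ z in L₂ x y..U₂ x y, f (x, y, z)` with no measurability or
integrability side condition. [cite: Hurley1980, Sect. 5.6 Thm. 6.3 (3)] [cite: DavisRabinowitz1984, Sect. 5.6.1 (5.6.1.1)] -/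
theorem setIntegral_closedRegionBetween₃_eq_iterated_of_continuous {L₁ U₁ : ℝ → ℝ} {L₂ U₂ : ℝ → ℝ → ℝ} {a b : ℝ}
    (hab : a ≤ b) (hL₁ : Continuous L₁) (hU₁ : Continuous U₁) (hL₂ : Continuous (uncurry L₂))
    (hU₂ : Continuous (uncurry U₂)) (h₁ : ∀ x ∈ Icc a b, L₁ x ≤ U₁ x)
    (h₂ : ∀ x ∈ Icc a b, ∀ y ∈ Icc (L₁ x) (U₁ x), L₂ x y ≤ U₂ x y) {f : ℝ × ℝ × ℝ → ℝ} (hf : Continuous f) :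
    ∫ p in closedRegionBetween₃ L₁ U₁ L₂ U₂ (Icc a b), f p =
      ∫ x in a..b, ∫ y in L₁ x..U₁ x, ∫ z in L₂ x y..U₂ x y, f (x, y, z) :=
  setIntegral_closedRegionBetween₃_eq_iterated hab hL₁.measurable hU₁.measurable hL₂.measurable hU₂.measurable h₁ h₂
    (hf.integrableOn_closedRegionBetween₃ hL₁ hU₁ hL₂ hU₂)

end Literature.MeasureTheory.Integral
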